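import Literature.Topology.FourManifolds.GompfShearConj
import HarnessLib

/-!
# Transfer of Gompf's twisting data along a fibrewise conjugation of the mapping torus

Adapter infrastructure for the framed form of R. Gompf, *More Cappell–Shaneson spheres are standard*,
Algebr. Geom. Topol. 10 (2010), Theorem 2.1 (the named fact
`Literature.Topology.FourManifolds.gompf2010_framedTwist`). `GompfTwistLocality.lean` transfers
fishtail twisting data (hypotheses of `nonempty_diffeomorph_prodSurgered_of_twistingDiffeo`)
between two monodromies with the same germ on the cylinder of `α`; this file transfers them along a
**fibrewise conjugation**: a diffeomorphism `h` of `T³` with `h ∘ ψ = ψ' ∘ h` induces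
`Ĥ : X_ψ ≅ X_{ψ'}`, `[x, s] ↦ [h x, s]`, and when `h` carries the product tube of radius `ε` onto the
product tube of radius `ε'` (`h (expT (sh_ε w)) = expT (sh_{ε'} w)`), twisting data for
`(ψ, δ, S, V_δ)` at radius `ε` become twisting data for `(ψ', h δ h⁻¹, h S, h V_δ)` at radius `ε'`,
with support control (`twistNbhd ψ η V ↦ twistNbhd ψ' η (h V)`). Two instances are used in
`GompfFramedTwistOfShearModel.lean`: the change of radius of the product tube (`ψ' = ψ`, `h` a radial
contraction near `1`) and the conjugation `𝔏 ↦ C 𝔏 C⁻¹` of the shear model (Gompf §3 ¶1: the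
construction "only depends on the conjugacy class").

* `Literature.Topology.FourManifolds.mtConj' h ψ ψ' hconj : MTorus ψ ≃ₘ MTorus ψ'` (uniqueness of
  open gluings with witnesses), `mtConj'_inl`, `mtConj'_inr`;
* `Literature.Topology.FourManifolds.imOpens h V` (the image of an open set of `T³`),
  `twistNbhd_mono`, `CircleNbhd.localOpens_mono`, `diffeoRestrOpens`;
* `Literature.Topology.FourManifolds.exists_twistingDiffeo_conjTransfer` — the transfer theorem.

Everything here is proved; no named facts are introduced.

## References

* R. E. Gompf, *More Cappell–Shaneson spheres are standard*, Algebr. Geom. Topol. 10 (2010)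
  1665–1681: §3 ¶1, Thm 2.1 (proof, last paragraph). [GompfAGT2010]
* M. W. Hirsch, *Differential Topology*, GTM 33 (1976), Ch. 8 §1, Thm. 1.3. [Hirsch1976]
-/

open scoped Manifold ContDiff Topology Real
open Set Function Metric Complex

noncomputable section

namespace Literature.Topology.FourManifolds

/-- Local notation: `𝔼 n` is the model Euclidean space `EuclideanSpace ℝ (Fin n)`. -/
local notation "𝔼 " n:arg => EuclideanSpace ℝ (Fin n)

/-- Local notation: `𝕊 n` is the unit sphere in `EuclideanSpace ℝ (Fin (n + 1))`. -/
local notation "𝕊 " n:arg => (Metric.sphere (0 : EuclideanSpace ℝ (Fin (n + 1))) 1)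

/-- Local notation: the model with corners `𝓣 = (𝓡 1).prod ((𝓡 1).prod (𝓡 1))` of `ThreeTorus`. -/
local notation "𝓣" =>
  (ModelWithCorners.prod (𝓡 1) (ModelWithCorners.prod (𝓡 1) (𝓡 1)))

/-! ### The conjugating diffeomorphism `X_ψ ≅ X_{ψ'}` for `h ψ = ψ' h` -/

section Conj

variable (h ψ ψ' : ThreeTorus ≃ₘ⟮𝓣, 𝓣⟯ ThreeTorus) (hconj : ∀ y, h (ψ y) = ψ' (h y))

include hconj in
/-- **`X_{ψ'}` is an open gluing of the two cylinders along the relation of `ψ`** when `h ψ = ψ' h`,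
with witnesses `inl ∘ (h × id)`, `inr ∘ (h × id)`. [cite: GompfAGT2010, §3 ¶1 (the construction only depends on the conjugacy class)] -/
theorem isOpenGluingWith_mTorus_conj' :
    IsOpenGluingWith (ModelWithCorners.prod 𝓣 𝓘(ℝ, ℝ)) (ModelWithCorners.prod 𝓣 𝓘(ℝ, ℝ)) (𝓡 4)
      (mappingTorusRel ⇑ψ)
      ((mtGlueData ψ').inl ∘ Prod.map ⇑h id)
      ((mtGlueData ψ').inr ∘ Prod.map ⇑h id) := by
  obtain ⟨hA, hAo, hB, hBo, hU, hR⟩ := isOpenGluingWith_mappingTorusGlued ψ' linTorusModel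
  have h1 : Function.Surjective (Prod.map ⇑h (id : ↥mappingTorusPieceOne → ↥mappingTorusPieceOne)) :=
    (EquivLike.surjective _).prodMap Function.surjective_id
  have h2 : Function.Surjective (Prod.map ⇑h (id : ↥mappingTorusPieceTwo → ↥mappingTorusPieceTwo)) :=
    (EquivLike.surjective _).prodMap Function.surjective_id
  refine ⟨?_, ?_, ?_, ?_, ?_, fun a b ↦ ?_⟩
  · have := hA.comp_diffeomorph (h.prodCongr (Diffeomorph.refl 𝓘(ℝ, ℝ) ↥mappingTorusPieceOne ∞))
    simpa only [Diffeomorph.coe_prodCongr, Diffeomorph.coe_refl] using this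
  · rwa [h1.range_comp]
  · have := hB.comp_diffeomorph (h.prodCongr (Diffeomorph.refl 𝓘(ℝ, ℝ) ↥mappingTorusPieceTwo ∞))
    simpa only [Diffeomorph.coe_prodCongr, Diffeomorph.coe_refl] using this
  · rwa [h2.range_comp]
  · rwa [h1.range_comp, h2.range_comp]
  · rw [Function.comp_apply, Function.comp_apply, hR]
    exact mappingTorusRel_prodMap_iff' (EquivLike.injective _) hconj a b

include hconj in
/-- **The conjugating diffeomorphism exists**: `Ĥ : X_ψ ≅ X_{ψ'}` with `Ĥ [x, s] = [h x, s]` on both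
cylinders. [cite: GompfAGT2010, §3 ¶1 (the construction only depends on the conjugacy class)] -/
theorem exists_mtConj' : ∃ Ψ : MTorus ψ ≃ₘ⟮𝓡 4, 𝓡 4⟯ MTorus ψ',
    (∀ a, Ψ ((mtGlueData ψ).inl a) = (mtGlueData ψ').inl (h a.1, a.2)) ∧
    (∀ b, Ψ ((mtGlueData ψ).inr b) = (mtGlueData ψ').inr (h b.1, b.2)) :=
  (isOpenGluingWith_mappingTorusGlued ψ linTorusModel).exists_diffeomorph_apply_eq
    (isOpenGluingWith_mTorus_conj' h ψ ψ' hconj)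

/-- **The conjugating diffeomorphism `Ĥ : X_ψ ≅ X_{ψ'}`, `[x, s] ↦ [h x, s]`**, for `h ψ = ψ' h`. [cite: GompfAGT2010, §3 ¶1 (the construction only depends on the conjugacy class)] -/
def mtConj' : MTorus ψ ≃ₘ⟮𝓡 4, 𝓡 4⟯ MTorus ψ' := (exists_mtConj' h ψ ψ' hconj).choose

/-- `Ĥ` on the first cylinder. [folklore] -/
theorem mtConj'_inl (a : ThreeTorus × ↥mappingTorusPieceOne) :
    mtConj' h ψ ψ' hconj ((mtGlueData ψ).inl a) = (mtGlueData ψ').inl (h a.1, a.2) :=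
  (exists_mtConj' h ψ ψ' hconj).choose_spec.1 a

/-- `Ĥ` on the second cylinder. [folklore] -/
theorem mtConj'_inr (b : ThreeTorus × ↥mappingTorusPieceTwo) :
    mtConj' h ψ ψ' hconj ((mtGlueData ψ).inr b) = (mtGlueData ψ').inr (h b.1, b.2) :=
  (exists_mtConj' h ψ ψ' hconj).choose_spec.2 b

/-- `Ĥ⁻¹` on the first cylinder. [folklore] -/
theorem mtConj'_symm_inl (a : ThreeTorus × ↥mappingTorusPieceOne) :
    (mtConj' h ψ ψ' hconj).symm ((mtGlueData ψ').inl a) = (mtGlueData ψ).inl (h.symm a.1, a.2) := by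
  have key : mtConj' h ψ ψ' hconj ((mtConj' h ψ ψ' hconj).symm ((mtGlueData ψ').inl a)) =
      mtConj' h ψ ψ' hconj ((mtGlueData ψ).inl (h.symm a.1, a.2)) := by
    rw [Diffeomorph.apply_symm_apply, mtConj'_inl, Diffeomorph.apply_symm_apply]
  exact (mtConj' h ψ ψ' hconj).injective key

/-- `Ĥ⁻¹` on the second cylinder. [folklore] -/
theorem mtConj'_symm_inr (b : ThreeTorus × ↥mappingTorusPieceTwo) :
    (mtConj' h ψ ψ' hconj).symm ((mtGlueData ψ').inr b) = (mtGlueData ψ).inr (h.symm b.1, b.2) := by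
  have key : mtConj' h ψ ψ' hconj ((mtConj' h ψ ψ' hconj).symm ((mtGlueData ψ').inr b)) =
      mtConj' h ψ ψ' hconj ((mtGlueData ψ).inr (h.symm b.1, b.2)) := by
    rw [Diffeomorph.apply_symm_apply, mtConj'_inr, Diffeomorph.apply_symm_apply]
  exact (mtConj' h ψ ψ' hconj).injective key

end Conj

/-! ### Images of opens, monotonicity, restriction of diffeomorphisms to opens -/

section Opens

/-- **The image `h V` of an open set of `T³` under a diffeomorphism** (written as the preimage under
`h⁻¹`). [folklore] -/
def imOpens (h : ThreeTorus ≃ₘ⟮𝓣, 𝓣⟯ ThreeTorus) (V : TopologicalSpace.Opens ThreeTorus) :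
    TopologicalSpace.Opens ThreeTorus :=
  ⟨h.symm ⁻¹' (V : Set ThreeTorus), V.2.preimage h.symm.continuous⟩

/-- Membership in the image. [folklore] -/
@[simp] theorem mem_imOpens {h : ThreeTorus ≃ₘ⟮𝓣, 𝓣⟯ ThreeTorus} {V : TopologicalSpace.Opens ThreeTorus}
    {y : ThreeTorus} : y ∈ imOpens h V ↔ h.symm y ∈ V := Iff.rfl

/-- `h y ∈ h V ↔ y ∈ V`. [folklore] -/
theorem apply_mem_imOpens {h : ThreeTorus ≃ₘ⟮𝓣, 𝓣⟯ ThreeTorus} {V : TopologicalSpace.Opens ThreeTorus}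
    {y : ThreeTorus} : h y ∈ imOpens h V ↔ y ∈ V := by
  rw [mem_imOpens, Diffeomorph.symm_apply_apply]

/-- **The twisted cylinder neighbourhood is monotone in the tube `V`.** [folklore] -/
theorem twistNbhd_mono (ψ : ThreeTorus ≃ₘ⟮𝓣, 𝓣⟯ ThreeTorus) (η : ℝ) {V W : TopologicalSpace.Opens ThreeTorus}
    (hVW : ∀ y ∈ V, y ∈ W) (K : Diffeotopy 𝓣 ThreeTorus) (φ₀ : ThreeTorus ≃ₘ⟮𝓣, 𝓣⟯ ThreeTorus)
    {p : MTorus ψ} (hp : p ∈ twistNbhd ψ η V K φ₀) : p ∈ twistNbhd ψ η W K φ₀ := by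
  rcases hp with ⟨a, ha⟩ | ⟨b, hb⟩
  · exact Or.inl ⟨⟨a.1, hVW _ a.2⟩, ha⟩
  · exact Or.inr ⟨b, hb⟩

/-- **`U` surgered is monotone in `U`.** [folklore] -/
theorem CircleNbhd.localOpens_mono {T : Type*} [TopologicalSpace T] [T2Space T] [ChartedSpace (𝔼 4) T]
    [IsManifold (𝓡 4) ∞ T] {c : 𝕊 1 → T} (ν : CircleNbhd (𝓡 4) c) {U W : TopologicalSpace.Opens T}
    (hUW : ∀ x ∈ U, x ∈ W) {p : ν.Surgered} (hp : p ∈ ν.localOpens U) : p ∈ ν.localOpens W := by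
  rcases (ν.mem_localOpens_iff).1 hp with ⟨a, ha, hap⟩ | ⟨d, hdp⟩
  · exact (ν.mem_localOpens_iff).2 (Or.inl ⟨a, hUW _ ha, hap⟩)
  · exact (ν.mem_localOpens_iff).2 (Or.inr ⟨d, hdp⟩)

/-- **Restriction of a diffeomorphism to open subsets it matches up.** [folklore] -/
def diffeoRestrOpens {M N : Type*} [TopologicalSpace M] [ChartedSpace (𝔼 4) M]
    [TopologicalSpace N] [ChartedSpace (𝔼 4) N]
    (e : M ≃ₘ⟮𝓡 4, 𝓡 4⟯ N) (U : TopologicalSpace.Opens M) (U' : TopologicalSpace.Opens N)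
    (hU : ∀ p, p ∈ U ↔ e p ∈ U') : ↥U ≃ₘ⟮𝓡 4, 𝓡 4⟯ ↥U' where
  toFun p := ⟨e p, (hU p).1 p.2⟩
  invFun p := ⟨e.symm p, (hU _).2 (by rw [e.apply_symm_apply]; exact p.2)⟩
  left_inv p := Subtype.ext (e.symm_apply_apply p)
  right_inv p := Subtype.ext (e.apply_symm_apply p)
  contMDiff_toFun := by
    refine (ContMDiff.subtypeVal_comp_iff _ _).1 ?_
    exact e.contMDiff.comp contMDiff_subtype_val
  contMDiff_invFun := by
    refine (ContMDiff.subtypeVal_comp_iff _ _).1 ?_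
    exact e.symm.contMDiff.comp contMDiff_subtype_val

/-- The value of the restriction. [folklore] -/
@[simp] theorem coe_diffeoRestrOpens {M N : Type*} [TopologicalSpace M] [ChartedSpace (𝔼 4) M]
    [TopologicalSpace N] [ChartedSpace (𝔼 4) N]
    (e : M ≃ₘ⟮𝓡 4, 𝓡 4⟯ N) (U : TopologicalSpace.Opens M) (U' : TopologicalSpace.Opens N)
    (hU : ∀ p, p ∈ U ↔ e p ∈ U') (p : ↥U) : (diffeoRestrOpens e U U' hU p : N) = e p := rfl

end Opens

/-! ### The conjugation transfer theorem -/

section Transfer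

variable (ψ ψ' h : ThreeTorus ≃ₘ⟮𝓣, 𝓣⟯ ThreeTorus) (hconj : ∀ y, h (ψ y) = ψ' (h y))
  {ε ε' : ℝ} (hε : 0 < ε) (hεπ : ε ≤ π) (hψ : ∀ v : 𝔼 3, ‖v‖ < ε → ψ (expT v) = expT v)
  (hε' : 0 < ε') (hε'π : ε' ≤ π) (hψ' : ∀ v : 𝔼 3, ‖v‖ < ε' → ψ' (expT v) = expT v)
  (hh : ∀ w : 𝔼 3, h (expT ((TubeTwist.const ε hε hεπ).shrink w)) =
    expT ((TubeTwist.const ε' hε' hε'π).shrink w))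
  {η : ℝ} (hη : 0 < η) (V V' : TopologicalSpace.Opens ThreeTorus) (hVV' : ∀ y ∈ V, h y ∈ V')
  (hVε : ∀ v : 𝔼 3, ‖v‖ < ε → expT v ∈ V)
  (g g' : ThreeTorus → ThreeTorus) (hgg' : ∀ y, h (g y) = g' (h y))
  {S S' : Set ThreeTorus} (hS : IsClosed S) (hS' : IsClosed S') (hSS' : ∀ y, y ∈ S ↔ h y ∈ S')
  (hSε : ∀ v : 𝔼 3, ‖v‖ < ε → expT v ∉ S) (hS'ε : ∀ v : 𝔼 3, ‖v‖ < ε' → expT v ∉ S')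
  (Vδ Vδ' : TopologicalSpace.Opens (ThreeTorus × ↥mappingTorusPieceTwo))
  (hV1 : ∀ b ∈ Vδ, b.1 ≠ 1) (hV1' : ∀ b ∈ Vδ', b.1 ≠ 1) (hVη : ∀ b ∈ Vδ, b ∈ bicollarPiece η)
  (hVδ : ∀ b' ∈ Vδ', (h.symm b'.1, b'.2) ∈ Vδ)

/-- The twisted cylinder neighbourhood for the trivial slide: `{[x, s] | x ∈ V} ∪ T³ × (1 - η, 1 + η)`.
Local abbreviation. -/
local notation "TN" ψ₀ ", " η₀ ", " V₀ => twistNbhd ψ₀ η₀ V₀ (Diffeotopy.refl 𝓣 ThreeTorus)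
  (Diffeomorph.refl 𝓣 ThreeTorus ∞)

/-- With the trivial slide, `cylMap` is `inl`. [folklore] -/
theorem cylMap_refl (ψ₀ : ThreeTorus ≃ₘ⟮𝓣, 𝓣⟯ ThreeTorus) (V₀ : TopologicalSpace.Opens ThreeTorus)
    (a : ↥(cylPiece V₀)) :
    cylMap ψ₀ V₀ (Diffeotopy.refl 𝓣 ThreeTorus) (Diffeomorph.refl 𝓣 ThreeTorus ∞) a =
      (mtGlueData ψ₀).inl a := by
  rw [cylMap, cylSlide_apply]
  rfl

/-- **Membership in the twisted cylinder neighbourhood for the trivial slide.** [folklore] -/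
theorem mem_twistNbhd_refl_iff (ψ₀ : ThreeTorus ≃ₘ⟮𝓣, 𝓣⟯ ThreeTorus) (η₀ : ℝ)
    (V₀ : TopologicalSpace.Opens ThreeTorus) (p : MTorus ψ₀) :
    p ∈ (TN ψ₀, η₀, V₀) ↔
      (∃ a : ThreeTorus × ↥mappingTorusPieceOne, a.1 ∈ V₀ ∧ (mtGlueData ψ₀).inl a = p) ∨
        ∃ b : ThreeTorus × ↥mappingTorusPieceTwo, b ∈ bicollarPiece η₀ ∧ (mtGlueData ψ₀).inr b = p := by
  rw [mem_twistNbhd_iff]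
  constructor
  · rintro (⟨a, ha⟩ | ⟨b, hb⟩)
    · exact Or.inl ⟨a, a.2, by rw [← ha, cylMap_refl]⟩
    · exact Or.inr ⟨b, b.2, hb⟩
  · rintro (⟨a, haV, hap⟩ | ⟨b, hbη, hbp⟩)
    · exact Or.inl ⟨⟨a, haV⟩, by rw [cylMap_refl]; exact hap⟩
    · exact Or.inr ⟨⟨b, hbη⟩, hbp⟩

include hconj in
/-- **`Ĥ` carries `twistNbhd ψ η V` onto `twistNbhd ψ' η (h V)`.** [folklore] -/
theorem mem_twistNbhd_iff_mtConj' (p : MTorus ψ) :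
    p ∈ (TN ψ, η, V) ↔ mtConj' h ψ ψ' hconj p ∈ (TN ψ', η, imOpens h V) := by
  rw [mem_twistNbhd_refl_iff, mem_twistNbhd_refl_iff]
  constructor
  · rintro (⟨a, haV, rfl⟩ | ⟨b, hbη, rfl⟩)
    · exact Or.inl ⟨(h a.1, a.2), apply_mem_imOpens.2 haV, (mtConj'_inl h ψ ψ' hconj a).symm⟩
    · refine Or.inr ⟨(h b.1, b.2), ?_, (mtConj'_inr h ψ ψ' hconj b).symm⟩
      rw [mem_bicollarPiece] at hbη ⊢
      exact hbη
  · rintro (⟨a, haV, hap⟩ | ⟨b, hbη, hbp⟩)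
    · refine Or.inl ⟨(h.symm a.1, a.2), mem_imOpens.1 haV, ?_⟩
      rw [← mtConj'_symm_inl h ψ ψ' hconj, hap, Diffeomorph.symm_apply_apply]
    · refine Or.inr ⟨(h.symm b.1, b.2), ?_, ?_⟩
      · rw [mem_bicollarPiece] at hbη ⊢
        exact hbη
      · rw [← mtConj'_symm_inr h ψ ψ' hconj, hbp, Diffeomorph.symm_apply_apply]

include hconj hh in
/-- **`Ĥ` carries the product tube of radius `ε` to the product tube of radius `ε'`.** [folklore] -/
theorem mtConj'_prodTube (q : (𝕊 1) × (𝔼 3)) :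
    mtConj' h ψ ψ' hconj ((prodTube ψ ε hε hεπ hψ).toFun q) = (prodTube ψ' ε' hε' hε'π hψ').toFun q := by
  obtain ⟨u, w⟩ := q
  by_cases hu : u = ptA
  · subst hu
    rw [prodTube_apply_of_ne_ptB ψ ε hε hεπ hψ ptA_ne_ptB, prodTube_apply_of_ne_ptB ψ' ε' hε' hε'π hψ' ptA_ne_ptB,
      mtConj'_inr]
    exact congrArg (fun x ↦ (mtGlueData ψ').inr (x, angBPt ptA)) (hh w)
  · rw [prodTube_apply_of_ne ψ ε hε hεπ hψ hu, prodTube_apply_of_ne ψ' ε' hε' hε'π hψ' hu, mtConj'_inl]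
    exact congrArg (fun x ↦ (mtGlueData ψ').inl (x, angAPt u)) (hh w)

/-- **Membership in the sliver complement**: `p ∉ inr (fibreSliver S)`. [folklore] -/
theorem mem_prodSliverCompl_iff (ψ₀ : ThreeTorus ≃ₘ⟮𝓣, 𝓣⟯ ThreeTorus) {S₀ : Set ThreeTorus}
    (hS₀ : IsClosed S₀) (p : MTorus ψ₀) :
    p ∈ prodSliverCompl ψ₀ hS₀ ↔ ∀ b ∈ fibreSliver S₀, (mtGlueData ψ₀).inr b ≠ p := by
  rw [prodSliverCompl, mem_sliverCompl_iff]
  constructor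
  · exact fun hp b hb hbp ↦ hp ⟨b, hb, hbp⟩
  · rintro hp ⟨b, hb, hbp⟩
    exact hp b hb hbp

include hSS' in
/-- `(h × id)` carries `fibreSliver S` onto `fibreSliver S'`. [folklore] -/
theorem mem_fibreSliver_iff_map (b : ThreeTorus × ↥mappingTorusPieceTwo) :
    b ∈ fibreSliver S ↔ (h b.1, b.2) ∈ fibreSliver S' := by
  rw [mem_fibreSliver_iff, mem_fibreSliver_iff]
  exact and_congr_left fun _ ↦ hSS' b.1

include hconj hSS' in
/-- **`Ĥ` preserves the sliver complements.** [folklore] -/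
theorem mem_prodSliverCompl_iff_mtConj' (p : MTorus ψ) :
    p ∈ prodSliverCompl ψ hS ↔ mtConj' h ψ ψ' hconj p ∈ prodSliverCompl ψ' hS' := by
  rw [mem_prodSliverCompl_iff, mem_prodSliverCompl_iff]
  constructor
  · intro hp b' hb' hbp
    have hb : (h.symm b'.1, b'.2) ∈ fibreSliver S := by
      rw [mem_fibreSliver_iff_map h hSS', Diffeomorph.apply_symm_apply]
      exact hb'
    refine hp _ hb ?_
    rw [← mtConj'_symm_inr h ψ ψ' hconj, hbp, Diffeomorph.symm_apply_apply]
  · intro hp b hb hbp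
    refine hp (h b.1, b.2) ((mem_fibreSliver_iff_map h hSS' b).1 hb) ?_
    rw [← hbp, mtConj'_inr]

set_option maxHeartbeats 800000 in
include hconj hh hη hVV' hVε hgg' hSS' hSε hS'ε hVη hVδ in
/-- **The conjugation transfer theorem.** Let `h` be a diffeomorphism of `T³` with `h ψ = ψ' h`
carrying the product tube of radius `ε` of `X_ψ` to the product tube of radius `ε'` of `X_{ψ'}`
(`h (expT (sh_ε w)) = expT (sh_{ε'} w)`), the tube `V` around `α` into `V'`, the twist `g` to `g'`
(`h g = g' h`) and the sliver set `S` onto `S'`; let `V_δ'` be a neighbourhood of the sliver of `S'`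
inside the bicollar with `(h⁻¹ × id) V_δ' ⊆ V_δ`. Then twisting data `G` for `(ψ, g, S, V_δ)` at radius
`ε` which are the identity off a closed subset of the surgered twisted cylinder neighbourhood
`twistNbhd ψ η V` give twisting data for `(ψ', g', S', V_δ')` at radius `ε'`, the identity off a
closed subset of the surgered `twistNbhd ψ' η V'`: conjugate by the diffeomorphism of the surgered
manifolds induced by `Ĥ = mtConj' h` (`CircleNbhd.exists_transfer_localOpens`). [cite: GompfAGT2010, §3 ¶1 and Thm 2.1 (proof, last paragraph)] -/
theorem exists_twistingDiffeo_conjTransfer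
    (G : ↥((prodTube ψ ε hε hεπ hψ).localOpens (prodSliverCompl ψ hS)) ≃ₘ⟮𝓡 4, 𝓡 4⟯
      ↥((prodTube ψ ε hε hεπ hψ).localOpens (prodSliverCompl ψ hS)))
    (hG : ∀ (x : ↥((prodTube ψ ε hε hεπ hψ).localOpens (prodSliverCompl ψ hS))) (b : ↥Vδ),
      (b : ThreeTorus × ↥mappingTorusPieceTwo) ∉ fibreSliver S →
        (x : prodSurgered ψ ε hε hεπ hψ) = (prodTube ψ ε hε hεπ hψ).glueData.inl
          (opensToComplement (prodTube ψ ε hε hεπ hψ) (mtGlueData ψ).inr Vδ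
            (inr_not_mem_range_secCircle_self ψ hε hεπ hψ Vδ hV1) b) →
          ∃ a' : ↥(prodTube ψ ε hε hεπ hψ).complement,
            (a' : MTorus ψ) = (mtGlueData ψ).inr (sliverTwist g b) ∧
              (G x : prodSurgered ψ ε hε hεπ hψ) = (prodTube ψ ε hε hεπ hψ).glueData.inl a')
    (Ksupp : Set (prodSurgered ψ ε hε hεπ hψ)) (hKc : IsClosed Ksupp)
    (hKU : Ksupp ⊆ (prodTube ψ ε hε hεπ hψ).localOpens (TN ψ, η, V))
    (hGK : ∀ x : ↥((prodTube ψ ε hε hεπ hψ).localOpens (prodSliverCompl ψ hS)),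
      (x : prodSurgered ψ ε hε hεπ hψ) ∉ Ksupp → G x = x) :
    ∃ (G' : ↥((prodTube ψ' ε' hε' hε'π hψ').localOpens (prodSliverCompl ψ' hS')) ≃ₘ⟮𝓡 4, 𝓡 4⟯
        ↥((prodTube ψ' ε' hε' hε'π hψ').localOpens (prodSliverCompl ψ' hS')))
      (Ksupp' : Set (prodSurgered ψ' ε' hε' hε'π hψ')),
      IsClosed Ksupp' ∧ Ksupp' ⊆ (prodTube ψ' ε' hε' hε'π hψ').localOpens (TN ψ', η, V') ∧
      (∀ x : ↥((prodTube ψ' ε' hε' hε'π hψ').localOpens (prodSliverCompl ψ' hS')),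
        (x : prodSurgered ψ' ε' hε' hε'π hψ') ∉ Ksupp' → G' x = x) ∧
      ∀ (x : ↥((prodTube ψ' ε' hε' hε'π hψ').localOpens (prodSliverCompl ψ' hS'))) (b : ↥Vδ'),
        (b : ThreeTorus × ↥mappingTorusPieceTwo) ∉ fibreSliver S' →
          (x : prodSurgered ψ' ε' hε' hε'π hψ') = (prodTube ψ' ε' hε' hε'π hψ').glueData.inl
            (opensToComplement (prodTube ψ' ε' hε' hε'π hψ') (mtGlueData ψ').inr Vδ'
              (inr_not_mem_range_secCircle_self ψ' hε' hε'π hψ' Vδ' hV1') b) →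
            ∃ a' : ↥(prodTube ψ' ε' hε' hε'π hψ').complement,
              (a' : MTorus ψ') = (mtGlueData ψ').inr (sliverTwist g' b) ∧
                (G' x : prodSurgered ψ' ε' hε' hε'π hψ') = (prodTube ψ' ε' hε' hε'π hψ').glueData.inl a' := by
  -- the conjugating diffeomorphism, restricted to the twisted cylinder neighbourhoods
  let Θ₀ : MTorus ψ ≃ₘ⟮𝓡 4, 𝓡 4⟯ MTorus ψ' := mtConj' h ψ ψ' hconj
  let Θ : ↥(TN ψ, η, V) ≃ₘ⟮𝓡 4, 𝓡 4⟯ ↥(TN ψ', η, imOpens h V) :=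
    diffeoRestrOpens Θ₀ _ _ (mem_twistNbhd_iff_mtConj' ψ ψ' h hconj V)
  have hΘ : ∀ p : ↥(TN ψ, η, V), ((Θ p : ↥(TN ψ', η, imOpens h V)) : MTorus ψ') = Θ₀ p := fun p ↦ rfl
  have he : ∀ (s : ℝ) (v : 𝔼 3), ‖v‖ < ε →
      slideFun (Diffeotopy.refl 𝓣 ThreeTorus) (Diffeomorph.refl 𝓣 ThreeTorus ∞) s (expT v) = expT v :=
    fun _ _ _ ↦ rfl
  have hVε' : ∀ v : 𝔼 3, ‖v‖ < ε' → expT v ∈ imOpens h V := by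
    intro v hv
    -- `expT v = sh_{ε'} w` for `w = sh_{ε'}⁻¹ v`, and `h (expT (sh_ε w)) = expT (sh_{ε'} w)`
    have hw : (TubeTwist.const ε' hε' hε'π).shrink ((TubeTwist.const ε' hε' hε'π).shrink.symm v) = v :=
      (TubeTwist.const ε' hε' hε'π).shrink_apply_symm_apply (mem_ball_zero_iff.2 hv)
    rw [← hw, ← hh, apply_mem_imOpens]
    exact hVε _ (TubeTwist.norm_shrink_const_lt hε hεπ _)
  have he' : ∀ (s : ℝ) (v : 𝔼 3), ‖v‖ < ε' →
      slideFun (Diffeotopy.refl 𝓣 ThreeTorus) (Diffeomorph.refl 𝓣 ThreeTorus ∞) s (expT v) = expT v :=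
    fun _ _ _ ↦ rfl
  have hνU : ∀ q, (prodTube ψ ε hε hεπ hψ).toFun q ∈ (TN ψ, η, V) :=
    prodTube_mem_twistNbhd ψ hε hεπ hψ hη V _ _ hVε he
  have hν'U' : ∀ q, (prodTube ψ' ε' hε' hε'π hψ').toFun q ∈ (TN ψ', η, imOpens h V) :=
    prodTube_mem_twistNbhd ψ' hε' hε'π hψ' hη (imOpens h V) _ _ hVε' he'
  have hΘν : ∀ q, ((Θ ⟨(prodTube ψ ε hε hεπ hψ).toFun q, hνU q⟩ : ↥(TN ψ', η, imOpens h V)) : MTorus ψ') =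
      (prodTube ψ' ε' hε' hε'π hψ').toFun q :=
    fun q ↦ mtConj'_prodTube ψ ψ' h hconj hε hεπ hψ hε' hε'π hψ' hh q
  have hνS : ∀ q, (prodTube ψ ε hε hεπ hψ).toFun q ∈ prodSliverCompl ψ hS :=
    prodTube_mem_sliverCompl ψ hε hεπ hψ hS hSε
  have hν'S : ∀ q, (prodTube ψ' ε' hε' hε'π hψ').toFun q ∈ prodSliverCompl ψ' hS' :=
    prodTube_mem_sliverCompl ψ' hε' hε'π hψ' hS' hS'ε
  have hΘS : ∀ p : ↥(TN ψ, η, V), (p : MTorus ψ) ∈ prodSliverCompl ψ hS ↔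
      ((Θ p : ↥(TN ψ', η, imOpens h V)) : MTorus ψ') ∈ prodSliverCompl ψ' hS' :=
    fun p ↦ mem_prodSliverCompl_iff_mtConj' ψ ψ' h hconj hS hS' hSS' p
  have htr := (prodTube ψ ε hε hεπ hψ).exists_transfer_localOpens (prodTube ψ' ε' hε' hε'π hψ') Θ hνU hΘν hν'U'
    hνS hν'S hΘS G Ksupp hKc hKU hGK
  obtain ⟨G', Ksupp', hK'c, hK'U, hG'K, hG'conj⟩ := htr
  refine ⟨G', Ksupp', hK'c, fun p hp ↦ ?_, hG'K, fun x b' hbS' hx ↦ ?_⟩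
  · -- support: `twistNbhd ψ' η (h V) ⊆ twistNbhd ψ' η V'`
    exact (prodTube ψ' ε' hε' hε'π hψ').localOpens_mono
      (fun x hx ↦ twistNbhd_mono ψ' η (fun y hy ↦ by
        have := hVV' _ (mem_imOpens.1 hy); rwa [Diffeomorph.apply_symm_apply] at this) _ _ hx)
      (hK'U hp)
  -- the twisting property: read `G` through `Θ` at the point `b = (h⁻¹ × id) b'`
  obtain ⟨bb, hbb⟩ := b'
  have hbV : (h.symm bb.1, bb.2) ∈ Vδ := hVδ bb hbb
  have hbS : (h.symm bb.1, bb.2) ∉ fibreSliver S := by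
    rw [mem_fibreSliver_iff_map h hSS', Diffeomorph.apply_symm_apply]
    exact hbS'
  have hhb : (h (h.symm bb.1, bb.2).1, (h.symm bb.1, bb.2).2) = bb := by
    rw [Diffeomorph.apply_symm_apply]
  have hbU : (h.symm bb.1, bb.2) ∈ bicollarPiece η := hVη _ hbV
  have haU : ((opensToComplement (prodTube ψ ε hε hεπ hψ) (mtGlueData ψ).inr Vδ
      (inr_not_mem_range_secCircle_self ψ hε hεπ hψ Vδ hV1) ⟨_, hbV⟩ : ↥(prodTube ψ ε hε hεπ hψ).complement) :
        MTorus ψ) ∈ (TN ψ, η, V) :=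
    bicollarMap_mem ψ η V _ _ ⟨_, hbU⟩
  have haS : ((opensToComplement (prodTube ψ ε hε hεπ hψ) (mtGlueData ψ).inr Vδ
      (inr_not_mem_range_secCircle_self ψ hε hεπ hψ Vδ hV1) ⟨_, hbV⟩ : ↥(prodTube ψ ε hε hεπ hψ).complement) :
        MTorus ψ) ∈ prodSliverCompl ψ hS :=
    (inr_mem_prodSliverCompl_iff ψ hS _).2 hbS
  -- `Θ a = inr' b'`, so `x = inl' (Θ a)`
  have hΘa : ((Θ ⟨_, haU⟩ : ↥(TN ψ', η, imOpens h V)) : MTorus ψ') = (mtGlueData ψ').inr bb := by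
    rw [hΘ, coe_opensToComplement]
    show mtConj' h ψ ψ' hconj ((mtGlueData ψ).inr (h.symm bb.1, bb.2)) = _
    rw [mtConj'_inr, hhb]
  have hx' : (x : prodSurgered ψ' ε' hε' hε'π hψ') = (prodTube ψ' ε' hε' hε'π hψ').glueData.inl
      ((prodTube ψ ε hε hεπ hψ).complementExtend (prodTube ψ' ε' hε' hε'π hψ') Θ hνU hΘν
        (opensToComplement (prodTube ψ ε hε hεπ hψ) (mtGlueData ψ).inr Vδ
          (inr_not_mem_range_secCircle_self ψ hε hεπ hψ Vδ hV1) ⟨_, hbV⟩)) := by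
    rw [hx]
    congr 1
    apply Subtype.ext
    rw [coe_opensToComplement, CircleNbhd.coe_complementExtend, CircleNbhd.extendMap_of_mem _ Θ haU, hΘa]
  -- `G (inl a) = inl a₁` with `a₁ = inr (sliverTwist g b)`
  have hGex := hG ⟨(prodTube ψ ε hε hεπ hψ).glueData.inl _, (prodTube ψ ε hε hεπ hψ).inl_mem_localOpens haS⟩
    ⟨_, hbV⟩ hbS rfl
  obtain ⟨a₁, ha₁, hGa⟩ := hGex
  have hb₁U : sliverTwist g (h.symm bb.1, bb.2) ∈ bicollarPiece η := by
    rw [mem_bicollarPiece, sliverTwist_snd]; exact hbU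
  have ha₁U : (a₁ : MTorus ψ) ∈ (TN ψ, η, V) := by
    rw [ha₁]; exact bicollarMap_mem ψ η V _ _ ⟨_, hb₁U⟩
  -- `h × id` carries `sliverTwist g b` to `sliverTwist g' b'`
  have htw : (h (sliverTwist g (h.symm bb.1, bb.2)).1, (sliverTwist g (h.symm bb.1, bb.2)).2) = sliverTwist g' bb := by
    by_cases h1 : 1 < (bb.2 : ℝ)
    · have h1b : 1 < ((h.symm bb.1, bb.2).2 : ℝ) := h1
      rw [sliverTwist_of_one_lt g h1b, sliverTwist_of_one_lt g' h1, hgg', Diffeomorph.apply_symm_apply]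
    · have h1b : ((h.symm bb.1, bb.2).2 : ℝ) ≤ 1 := not_lt.1 h1
      rw [sliverTwist_of_le_one g h1b, sliverTwist_of_le_one g' (not_lt.1 h1), hhb]
  have hΘa₁ : ((Θ ⟨(a₁ : MTorus ψ), ha₁U⟩ : ↥(TN ψ', η, imOpens h V)) : MTorus ψ') =
      (mtGlueData ψ').inr (sliverTwist g' bb) := by
    rw [hΘ]
    show mtConj' h ψ ψ' hconj (a₁ : MTorus ψ) = _
    rw [ha₁, mtConj'_inr, htw]
  refine ⟨(prodTube ψ ε hε hεπ hψ).complementExtend (prodTube ψ' ε' hε' hε'π hψ') Θ hνU hΘν a₁, ?_,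
    hG'conj x _ a₁ haU haS hx' hGa ha₁U⟩
  rw [CircleNbhd.coe_complementExtend, CircleNbhd.extendMap_of_mem _ Θ ha₁U, hΘa₁]

end Transfer

end Literature.Topology.FourManifolds
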